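import Summits.SmoothPoincare4.SmoothPoincare4.Statement
import Summits.SmoothPoincare4.SmoothPoincare4.Theorems.SoloInformedGabaiPoincareBalls
import Literature.Topology.FourManifolds.MorseTwoCriticalPoints
import Literature.Topology.FourManifolds.CorkDecompositionMiddleLevelProofs
import Literature.Topology.FourManifolds.MorseExistence
import Literature.Topology.FourManifolds.GluingProofs
import Literature.Topology.FourManifolds.CerfGammaFour
import Literature.Topology.FourManifolds.SmoothPoincareLowDim
import Literature.Topology.FourManifolds.HomotopySphereSuperlevelContractible
import HarnessLib
import HarnessLib.Audit.Tags

/-!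
# SPC4 from the Poincaré-ball double conjecture and the Schoenflies conjecture, kernel-checked

Host summit `SmoothPoincare4` (soloist seat `solo-SmoothPoincare4-informed`).  D. Gabai,
*3-Spheres in the 4-Sphere and Pseudo-Isotopies of `S¹ × S³`*, arXiv:2212.02004v2 (2024), §13,
p. 62: *"It is well known that the smooth 4-dimensional Poincaré conjecture (SPC4) follows from the
Schoenflies conjecture and the Poincaré ball embedding conjecture."*  This file PROVES that
sentence over the tree's vocabulary, with the Poincaré ball embedding conjecture replaced by the
(stronger, Gabai Conj. 13.1 / Remarks 13.2 (i)) double form `PoincareBallDoubleConjecture` of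
`SoloInformedGabaiPoincareBalls.lean` (which implies it:
`poincareBallEmbeddingConjecture_of_doubleConjecture`, whose gluing-existence hypothesis is
discharged here by `exists_isBoundaryGluing_holds`, `GluingProofs.lean`) and the Schoenflies
conjecture in GABAI'S BALL FORM (p. 62: *"A Schoenflies 4-ball is a Poincaré 4-ball that embeds in
`S⁴`"*; Def. 1.3; the Schoenflies conjecture = every Schoenflies ball is `B⁴`), carried INLINE as
the hypothesis `hS` of the main theorem: every compact Hausdorff second-countable smooth
4-manifold with boundary `W` whose boundary is diffeomorphic to `S³` and which smoothly embeds in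
the round `S⁴` is diffeomorphic to the closed 4-disc (contractibility is then automatic and is
not assumed).  A named `@[conjecture]` constant for it (`SchoenfliesBallConjectureFour`) is filed
separately (review-queued definitions, D-0009).

Main theorem `smoothPoincare4_of_poincareBallDouble_of_schoenfliesBall`:

  `PoincareBallDoubleConjecture → (Schoenflies, ball form) → cerf_twistedSphere_four →`
  `SmoothPoincare4`.

The last hypothesis is a CLASSICAL THEOREM carried as a named fact (not a conjecture):
`cerf_twistedSphere_four` is the tree's `Γ₄ = 0` (Cerf 1968, `CerfGammaFour.lean`).  The other
classical input, "a homotopy 4-sphere with the interior of a disc deleted is contractible"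
(Kosinski 1993, Ch. VI §1, sentence before Cor. 1.4), is PROVED in the Literature library in the
regular-superlevel form used here
(`RegularSublevel.contractibleSpace_superlevel_of_homotopyEquiv_sphere`,
`HomotopySphereSuperlevelContractible.lean`, from the tree's
`contractibleSpace_compl_singleton_of_homotopyEquiv_sphere_univ` and a deformation retraction
pasted along the level).

PROVED here (no named fact introduced for these steps):

* `IsMorse.nonempty_diffeomorph_closedBall_regularSublevel_of_forall` — the disc lemma of
  `MorseTwoCriticalPoints.lean` with the hypothesis "the critical set is `{p, q}`" weakened to "`p`
  (of index `0`) is the only critical point in `{f ≤ a}`" (Milnor 1963, Thm. 3.1 + Lemma of Morse,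
  via the tree's `IsMorseAdapted.nonempty_diffeomorph_closedBall`);
* `exists_isBoundaryGluing_superlevel_closedBall` — PUNCTURING: every closed smooth manifold `M`
  of dimension `k + 1 ≥ 2` (in `Type`) is a boundary gluing `M = M_a ∪_φ 𝔻ᵏ⁺¹` of a regular
  superlevel set `M_a = {a ≤ f}` of a Morse function `f` with the closed disc, along a
  diffeomorphism `φ : ∂M_a ≅ Sᵏ`, the complementary sublevel set `{f ≤ a}` being a disc (Morse
  function with distinct critical values, Milnor 1965 Lemma 2.8; `a` just above the minimum;
  `RegularSublevel.isBoundaryGluing_split` and `IsBoundaryGluing.transfer`);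
* `smoothPoincare4_of_poincareBallDouble_of_schoenfliesBall` — the assembly: for a homotopy
  4-sphere `M` (compact by `compactSpace_of_homotopyEquiv_sphere`), puncture `M = W ∪_φ 𝔻⁴`; `W` is
  a compact contractible 4-manifold with `∂W ≅ S³` (contractible by the Literature theorem above),
  i.e. a Poincaré ball; by the double
  conjecture it embeds in `S⁴` (proved deduction), so it is a Schoenflies ball, hence `W ≅ 𝔻⁴` by the
  Schoenflies conjecture; transporting the gluing along `W ≅ 𝔻⁴` exhibits `M` as a twisted sphere
  `𝔻⁴ ∪_χ 𝔻⁴`, which is diffeomorphic to `S⁴` by Cerf.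

STATUS: hypothesis `hS` is OPEN (the smooth 4-dimensional Schoenflies problem, ball form);
`PoincareBallDoubleConjecture` is OPEN (Gabai Conj. 13.1).  Their conjunction implies SPC4 by the
main theorem; conversely SPC4 implies both (classical; not formalised here).  Nothing in this file
claims either conjecture.

## References

* D. Gabai, *3-Spheres in the 4-Sphere and Pseudo-Isotopies of `S¹ × S³`*, arXiv:2212.02004v2
  (2024), §13 p. 62 and Def. 1.3 p. 3. [cite: Gabai2022, §13 p. 62]
* A. Kosinski, *Differential Manifolds* (1993), Ch. VI §1 (sentence preceding Cor. 1.4: "if `Σ` is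
  a homotopy sphere, then `Σ` with the interior of a disc deleted is a contractible manifold").
  [cite: Kosinski1993, VI §1, before Cor. 1.4]
* J. Cerf, *Sur les difféomorphismes de la sphère de dimension trois (`Γ₄ = 0`)*, LNM 53 (1968).
  [cite: Cerf1968, main theorem (Γ₄ = 0)]
* J. Milnor, *Morse theory* (1963), Thm. 3.1, Thm. 4.1; *Lectures on the h-cobordism theorem*
  (1965), Lemma 2.8. [cite: Milnor1963, Thm. 4.1] [cite: MilnorHCobordism1965, Lemma 2.8]
-/

noncomputable section

open scoped Manifold ContDiff Topology
open Set Function ContinuousMap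

namespace Summit.SmoothPoincare4.SmoothPoincare4.Theorems

open Literature.Topology.FourManifolds

/-! ### Puncturing a closed manifold: `M = M_a ∪_φ 𝔻ᵏ⁺¹` -/

section Puncture

variable {k : ℕ} {M : Type} [TopologicalSpace M] [T2Space M] [CompactSpace M]
  [ChartedSpace (EuclideanSpace ℝ (Fin (k + 1))) M] [IsManifold (𝓡 (k + 1)) ∞ M] {f : M → ℝ}
  {p : M} {a : ℝ}

/-- **The sublevel set below the second critical value is a disc.**  If `p` is a critical point of
index `0` of the Morse function `f` on the closed manifold `M` (dimension `k + 1 ≥ 2`), `a` is a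
regular level with `f p ≤ a`, and `p` is the only critical point with value `≤ a`, then
`Mᵃ = {f ≤ a} ≅ 𝔻ᵏ⁺¹`: the adapted Morse function on `Mᵃ` (`RegularSublevel.morseData`) has the
single critical point `p`, of index `0`, and the tree's disc lemma
`IsMorseAdapted.nonempty_diffeomorph_closedBall` applies (Milnor 1963, Thm. 3.1 and the Lemma of
Morse; proof of Thm. 4.1). [cite: Milnor1963, proof of Thm. 4.1 (p. 25)] -/
theorem IsMorse.nonempty_diffeomorph_closedBall_regularSublevel_of_forall (hk : 1 ≤ k)
    (hf : IsMorse (𝓡 (k + 1)) f) (hpc : IsMCriticalPt (𝓡 (k + 1)) f p)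
    (hp0 : morseIndex (𝓡 (k + 1)) f p = 0) (hpa : f p ≤ a)
    (huniq : ∀ x, IsMCriticalPt (𝓡 (k + 1)) f x → f x ≤ a → x = p)
    (h : IsRegularLevel (𝓡 (k + 1)) f a) :
    Nonempty (RegularSublevel h ≃ₘ⟮𝓡∂ (k + 1), 𝓡∂ (k + 1)⟯
      (Metric.closedBall (0 : EuclideanSpace ℝ (Fin (k + 1))) 1)) := by
  obtain ⟨hFa, hFcrit, hFind⟩ := RegularSublevel.morseData hf h
  set P : RegularSublevel h := RegularSublevel.mk h p hpa with hP
  have hPc : IsMCriticalPt (𝓡∂ (k + 1))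
      (fun x : RegularSublevel h => f (RegularSublevel.incl h x) + (1 - a)) P :=
    (hFcrit P).2 hpc
  have huniq' : ∀ x : RegularSublevel h, IsMCriticalPt (𝓡∂ (k + 1))
      (fun x : RegularSublevel h => f (RegularSublevel.incl h x) + (1 - a)) x → x = P := by
    intro x hx
    have hxc : IsMCriticalPt (𝓡 (k + 1)) f (RegularSublevel.incl h x) := (hFcrit x).1 hx
    exact RegularSublevel.injective_incl h
      (by rw [hP, RegularSublevel.incl_mk]; exact huniq _ hxc (RegularSublevel.apply_incl_le h x))
  have h0 : morseIndex (𝓡∂ (k + 1))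
      (fun x : RegularSublevel h => f (RegularSublevel.incl h x) + (1 - a)) P = 0 :=
    (hFind P hpc).trans hp0
  exact hFa.nonempty_diffeomorph_closedBall hk hPc huniq' h0

variable (M) in
/-- **Puncturing a closed manifold.**  Every nonempty closed (compact, Hausdorff, second-countable,
boundaryless) smooth manifold `M` of dimension `k + 1 ≥ 2` in `Type` is a boundary gluing
`M = M_a ∪_φ 𝔻ᵏ⁺¹` (`IsBoundaryGluing`) of the regular superlevel set `M_a = {a ≤ f}` of a Morse
function `f` (a compact smooth manifold with boundary, `RegularSuperlevel`) with the closed disc,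
along a diffeomorphism `φ : ∂M_a ≅ Sᵏ`.  Proof: a Morse function with distinct critical values
(`exists_isMorse_holds`, `IsMorse.exists_isMorse_injOn_criticalSet`: Milnor 1965, Lemma 2.8); its
minimum `p` is critical of index `0` (`IsLocalMin.isMCriticalPt`, `morseIndex_eq_zero_of_isLocalMin`);
a level `a` strictly between `f p` and every other critical value is regular and `{f ≤ a} ≅ 𝔻ᵏ⁺¹`
(`IsMorse.nonempty_diffeomorph_closedBall_regularSublevel_of_forall`); split `M` at `a`
(`RegularSublevel.isBoundaryGluing_split`) and transport the lower piece to the disc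
(`IsBoundaryGluing.transfer`).  Milnor 1963, proof of Thm. 4.1 ("`Mᵃ` is a closed `n`-cell").
[cite: Milnor1963, proof of Thm. 4.1 (p. 25)] [cite: MilnorHCobordism1965, Lemma 2.8 (PDF p. 11)] -/
theorem exists_isBoundaryGluing_superlevel_closedBall [SecondCountableTopology M] [Nonempty M]
    (hk : 1 ≤ k) :
    ∃ (f : M → ℝ) (a : ℝ) (h : IsRegularLevel (𝓡 (k + 1)) f a)
      (φ : (RegularSublevel.boundaryData h.const_sub).carrier ≃ₘ⟮𝓡 k, 𝓡 k⟯
        (Metric.sphere (0 : EuclideanSpace ℝ (Fin (k + 1))) 1)),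
      IsBoundaryGluing (RegularSublevel.boundaryData h.const_sub) (closedBallBoundaryData k) φ
        (𝓡 (k + 1)) M ∧
      Nonempty (RegularSublevel h ≃ₘ⟮𝓡∂ (k + 1), 𝓡∂ (k + 1)⟯
        (Metric.closedBall (0 : EuclideanSpace ℝ (Fin (k + 1))) 1)) := by
  classical
  -- a Morse function with distinct critical values
  obtain ⟨f₀, hf₀⟩ := exists_isMorse_holds (k + 1) M
  obtain ⟨f, hf, hinj⟩ := hf₀.exists_isMorse_injOn_criticalSet
  -- its minimum `p`: a critical point of index `0`
  obtain ⟨p, -, hpmin⟩ :=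
    isCompact_univ.exists_isMinOn univ_nonempty hf.contMDiff.continuous.continuousOn
  have hple : ∀ x, f p ≤ f x := fun x => hpmin (mem_univ x)
  have hploc : IsLocalMin f p := hpmin.isLocalMin Filter.univ_mem
  have hpc : IsMCriticalPt (𝓡 (k + 1)) f p := hploc.isMCriticalPt
  have hp0 : morseIndex (𝓡 (k + 1)) f p = 0 := hf.morseIndex_eq_zero_of_isLocalMin hploc
  -- a level `a` just above `f p`, below every other critical value
  have hfin : (criticalSet (𝓡 (k + 1)) f).Finite := IsMorse.finite_criticalSet_holds hf
  have key : ∃ a : ℝ, f p < a ∧ ∀ x ∈ criticalSet (𝓡 (k + 1)) f, x ≠ p → a < f x := by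
    by_cases hne : (criticalSet (𝓡 (k + 1)) f \ {p}).Nonempty
    · obtain ⟨q, hq, hqmin⟩ := Set.exists_min_image _ f hfin.sdiff hne
      have hqp : q ≠ p := fun h => hq.2 (by simp [h])
      have hpq : f p < f q := lt_of_le_of_ne (hple q) fun hEq => hqp (hinj hq.1 hpc hEq.symm)
      refine ⟨(f p + f q) / 2, by linarith, fun x hx hxp => ?_⟩
      have hqx : f q ≤ f x := hqmin x ⟨hx, by simpa using hxp⟩
      linarith
    · refine ⟨f p + 1, by linarith, fun x hx hxp => ?_⟩
      exact absurd ⟨x, hx, by simpa using hxp⟩ hne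
  obtain ⟨a, hpa, hgt⟩ := key
  have h : IsRegularLevel (𝓡 (k + 1)) f a := hf.isRegularLevel fun z hz => by
    by_cases hzp : z = p
    · rw [hzp]; exact hpa.ne
    · exact (hgt z hz hzp).ne'
  -- the lower piece `{f ≤ a}` is a disc
  have huniq : ∀ x, IsMCriticalPt (𝓡 (k + 1)) f x → f x ≤ a → x = p := by
    intro x hx hxa
    by_contra hxp
    exact absurd hxa (not_le.2 (hgt x hx hxp))
  obtain ⟨Ψ⟩ := hf.nonempty_diffeomorph_closedBall_regularSublevel_of_forall hk hpc hp0 hpa.le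
    huniq h
  -- `M = Mᵃ ∪ M_a`; replace the lower half by the disc; swap the pieces
  have G₀ := RegularSublevel.isBoundaryGluing_split h
  have G₁ := IsBoundaryGluing.transfer (b₁ := closedBallBoundaryData k) Ψ.symm G₀
  set φ₁ : (Metric.sphere (0 : EuclideanSpace ℝ (Fin (k + 1))) 1) ≃ₘ⟮𝓡 k, 𝓡 k⟯
      (RegularSublevel.boundaryData h.const_sub).carrier :=
    ((closedBallBoundaryData k).restrictDiffeomorph (RegularSublevel.boundaryData h) Ψ.symm).trans
      (RegularSublevel.splitDiffeomorph h) with hφ₁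
  have G₁' : IsBoundaryGluing (closedBallBoundaryData k) (RegularSublevel.boundaryData h.const_sub)
      φ₁ (𝓡 (k + 1)) M :=
    G₁
  exact ⟨f, a, h, φ₁.symm, G₁'.symm', ⟨Ψ⟩⟩

end Puncture

/-! ### The assembly -/

/-- **SPC4 from the Poincaré-ball double conjecture and the Schoenflies conjecture** (Gabai 2022,
§13 p. 62: *"SPC4 follows from the Schoenflies conjecture and the Poincaré ball embedding
conjecture"*, with the embedding conjecture strengthened to the double form of Conj. 13.1 /
Remarks 13.2 (i), which implies it — `poincareBallEmbeddingConjecture_of_doubleConjecture`, its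
gluing hypothesis discharged by `exists_isBoundaryGluing_holds` — and the Schoenflies conjecture in
Gabai's ball form `hS`: every compact smooth 4-manifold with boundary `≅ S³` that smoothly embeds
in `S⁴` is diffeomorphic to `𝔻⁴`; Gabai 2022 p. 62 and Def. 1.3).  Given also the classical fact `Γ₄ = 0` (`cerf_twistedSphere_four`, Cerf
1968), every Hausdorff second-countable smooth 4-manifold homotopy equivalent to `S⁴` is
diffeomorphic to `S⁴`.  Proof: `M` is compact (`compactSpace_of_homotopyEquiv_sphere`); puncture
`M = W ∪_φ 𝔻⁴` (`exists_isBoundaryGluing_superlevel_closedBall`); `W` is contractible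
(`RegularSublevel.contractibleSpace_superlevel_of_homotopyEquiv_sphere`, Kosinski VI §1), so a
Poincaré ball, hence embeds in `S⁴`,
hence is a Schoenflies ball, hence `W ≅ 𝔻⁴`; transporting the gluing (`IsBoundaryGluing.transfer`)
makes `M` a twisted sphere `𝔻⁴ ∪_χ 𝔻⁴ ≅ S⁴`. [cite: Gabai2022, §13 p. 62] -/
theorem smoothPoincare4_of_poincareBallDouble_of_schoenfliesBall
    (hD : PoincareBallDoubleConjecture)
    (hS : ∀ (W : Type) [TopologicalSpace W] [T2Space W] [SecondCountableTopology W]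
      [ChartedSpace (EuclideanHalfSpace (3 + 1)) W] [IsManifold (𝓡∂ (3 + 1)) ∞ W] [CompactSpace W]
      (b : BoundaryData (𝓡∂ (3 + 1)) W (𝓡 3)),
      Nonempty (b.carrier ≃ₘ⟮𝓡 3, 𝓡 3⟯ (Metric.sphere (0 : EuclideanSpace ℝ (Fin (3 + 1))) 1)) →
      (∃ φ : W → (Metric.sphere (0 : EuclideanSpace ℝ (Fin (3 + 1 + 1))) 1),
        Manifold.IsSmoothEmbedding (𝓡∂ (3 + 1)) (𝓡 (3 + 1)) ∞ φ) →
      Nonempty (W ≃ₘ⟮𝓡∂ (3 + 1), 𝓡∂ (3 + 1)⟯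
        (Metric.closedBall (0 : EuclideanSpace ℝ (Fin (3 + 1))) 1)))
    (hC : cerf_twistedSphere_four) : SmoothPoincare4 := by
  intro M _ _ _ _ _ e
  haveI : CompactSpace M := compactSpace_of_homotopyEquiv_sphere (n := 4) (by norm_num) M e
  obtain ⟨y, hy⟩ := (NormedSpace.sphere_nonempty (E := EuclideanSpace ℝ (Fin (4 + 1)))
    (x := (0 : EuclideanSpace ℝ (Fin (4 + 1)))) (r := (1 : ℝ))).2 zero_le_one
  haveI : Nonempty M := ⟨e.symm.toFun ⟨y, hy⟩⟩
  -- puncture: `M = W ∪_ψ 𝔻⁴`, `W = {a ≤ f}`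
  obtain ⟨f, a, h, ψ, G, ⟨Ψ⟩⟩ :=
    exists_isBoundaryGluing_superlevel_closedBall M (k := 3) (by norm_num)
  -- `W` is a Poincaré ball (Kosinski VI §1: a homotopy sphere minus an open disc is contractible)
  haveI : ContractibleSpace (RegularSuperlevel h) :=
    RegularSublevel.contractibleSpace_superlevel_of_homotopyEquiv_sphere (by norm_num) h Ψ e
  -- it embeds in `S⁴` (double conjecture ⇒ embedding conjecture) ...
  have hE : PoincareBallEmbeddingConjecture :=
    poincareBallEmbeddingConjecture_of_doubleConjecture
      (fun W _ _ _ _ _ _ b => exists_isBoundaryGluing_holds b b) hD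
  obtain ⟨φ, hφ⟩ := hE (RegularSuperlevel h) (RegularSublevel.boundaryData h.const_sub) ⟨ψ⟩
  -- ... so it is a Schoenflies ball, hence a disc
  obtain ⟨g⟩ := hS (RegularSuperlevel h) (RegularSublevel.boundaryData h.const_sub) ⟨ψ⟩ ⟨φ, hφ⟩
  -- `M = 𝔻⁴ ∪_χ 𝔻⁴` is a twisted sphere, diffeomorphic to `S⁴` by Cerf
  have G₃ := IsBoundaryGluing.transfer (b₁ := closedBallBoundaryData 3) g.symm G
  exact hC (((closedBallBoundaryData 3).restrictDiffeomorph
      (RegularSublevel.boundaryData h.const_sub) g.symm).trans ψ)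
    { carrier := M, isTwistedSphere := G₃ }

end Summit.SmoothPoincare4.SmoothPoincare4.Theorems

end
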